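import Mathlib
import HarnessLib
import Summits.HubbardSuperconductivity.HubbardSuperconductivity.Theorems.KLProgrammeKLRegimeEngineScaleZeroE1Final
import Summits.HubbardSuperconductivity.HubbardSuperconductivity.Theorems.KLProgrammeKLRegimeEngineScaleZeroE1Gfr0
import Summits.HubbardSuperconductivity.HubbardSuperconductivity.Theorems.KLProgrammeKLRegimeEngineScaleZeroThetaPackage

/-!
# K3 engine child (`KLRegimeEngineV14`, stmt-HubbardSuperconductivity-19918), stub `stub_engine_scale0`: the (E1-v4)₀ size `klE1CE P`
# (the ONE package number of the scale-`0` kernel-norm clause) and the clause under the engine's binders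

Cell gate-hubbard-kl, seat hubbard-kl-k3c2-p1.  `kernelNormsV4_zero_of_klEng` (`…ScaleZeroE1Final`) proves `KernelNormsV4 … 0` for every
admissible frame given three numbers; two of them hold under the engine's existing threshold `klEngU₀3`
(`gfr0_abs_mul_le_of_le_klEngU₀3`, `klScaleZeroThetaC_mul_le_half_of_le_klEngU₀3`).  The third is a lower bound on `Q.CE`; here it
gets a NAME, **`klE1CE P`** (a closed-form real depending on `P.Klam` and the absolute constants `klScaleZeroA0`, `sectorCircLineConst`,
`klE0`, `klBetaMin`), so that the engine's `∃Q` witness can take `CE := max (…) (klE1CE P)` (plan2's «Q4-by-name»), and the clause is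
restated under exactly the binders of `stub_engine_scale0`:

* `klE1CE` (definition), `klE1CE_nonneg`;
* **`kernelNormsV4_zero_of_klEng_of_le_CE`** — `P.WF`-free form: `R.WF → 0 < P.Klam → 0 < U ≤ 1 → U ≤ klEngU₀3 P R c → FrameOK R U N μ K →
  μ ∈ klWindowC → klBetaMin ≤ β → klEngL₃ β U ≤ L → klEngM₃ β U L ≤ M → klE1CE P ≤ Q.CE → KernelNormsV4 L M P Q β U μ K 0`.
-/

noncomputable section

namespace Summit.HubbardSuperconductivity.HubbardSuperconductivity.Theorems.EngineV8

set_option linter.dupNamespace false -- summit = problem name (single-conjunct summit), D-0017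

open Real Finset Literature.MathematicalPhysics.QuantumLattice Literature.Probability.LatticeModels
open Summit.HubbardSuperconductivity.HubbardSuperconductivity.Theorems.KLRegimeSplit
open Summit.HubbardSuperconductivity.HubbardSuperconductivity.Theorems.KLProgrammeLegKernels

/-- **`klE1CE P`** — the (E1-v4)₀ lower bound for the engine's `Q.CE`:
`2C_T²/κ₀²·max(1, 16e⁹κ₀²·klScaleZeroA0)·max(1, 4e⁹κ₀⁴)·max(1, Klam⁻¹)`, `κ₀² = 2·6054`,
`C_T = √(2048(16π/e₀+1)Φ(s₁))·√(64·1794e₀(e₀/π + 1/klBetaMin))`, `Φ(s) = 4(2√2/s+2)² + 16(1/s+1)²`,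
`s₁ = 2/(π(22484224/9 + (7180/3)·sectorCircLineConst + 1))`. -/
def klE1CE (P : SplitConsts) : ℝ :=
  2 * (Real.sqrt (2048 * (16 * Real.pi / klE0 + 1) *
        (4 * ((2 * Real.sqrt 2 / (2 / (Real.pi * ((22484224 / 9 + 7180 / 3 * sectorCircLineConst) + 1))) + 2) *
          (2 * Real.sqrt 2 / (2 / (Real.pi * ((22484224 / 9 + 7180 / 3 * sectorCircLineConst) + 1))) + 2)) +
          16 * (1 / (2 / (Real.pi * ((22484224 / 9 + 7180 / 3 * sectorCircLineConst) + 1))) + 1) ^ 2)) *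
      Real.sqrt (64 * (1794 * klE0) * (klE0 / Real.pi + 1 / klBetaMin))) ^ 2 / Real.sqrt (2 * (7 + 6047)) ^ 2 *
    max 1 (16 * Real.exp 1 ^ 9 * Real.sqrt (2 * (7 + 6047)) ^ 2 * klScaleZeroA0) *
    max 1 (4 * Real.exp 1 ^ 9 * Real.sqrt (2 * (7 + 6047)) ^ 4) * max 1 P.Klam⁻¹

/-- `0 ≤ klE1CE P`. -/
theorem klE1CE_nonneg (P : SplitConsts) : 0 ≤ klE1CE P := by
  unfold klE1CE
  have h1 : (0 : ℝ) ≤ max 1 (16 * Real.exp 1 ^ 9 * Real.sqrt (2 * (7 + 6047)) ^ 2 * klScaleZeroA0) :=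
    le_trans zero_le_one (le_max_left _ _)
  have h2 : (0 : ℝ) ≤ max 1 (4 * Real.exp 1 ^ 9 * Real.sqrt (2 * (7 + 6047)) ^ 4) := le_trans zero_le_one (le_max_left _ _)
  have h3 : (0 : ℝ) ≤ max 1 P.Klam⁻¹ := le_trans zero_le_one (le_max_left _ _)
  positivity

/-- **(E1-v4)₀ under the engine's binders, one package number**: `R.WF`, `0 < P.Klam`, `0 < U ≤ 1`, `U ≤ klEngU₀3 P R c`,
`FrameOK R U N μ K`, `μ ∈ klWindowC`, `klBetaMin ≤ β`, `klEngL₃ β U ≤ L`, `klEngM₃ β U L ≤ M`, `klE1CE P ≤ Q.CE`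
⟹ `KernelNormsV4 L M P Q β U μ K 0`. -/
theorem kernelNormsV4_zero_of_klEng_of_le_CE {L M : ℕ} [NeZero L] [NeZero M] {R : RenConsts} (hR : R.WF)
    {P : SplitConsts} (hP : 0 < P.Klam) {c U : ℝ} (hU : 0 < U) (hU1 : U ≤ 1) (hU₀ : U ≤ klEngU₀3 P R c)
    {N : ℕ} {μ : ℝ} {K : TrigPolyC4v} (hK : FrameOK R U N μ K) (hμ : μ ∈ klWindowC) {β : ℝ} (hβ : klBetaMin ≤ β)
    (hL : klEngL₃ β U ≤ L) (hM : klEngM₃ β U L ≤ M) {Q : EngConsts} (hQ : klE1CE P ≤ Q.CE) :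
    KernelNormsV4 L M P Q β U μ K 0 :=
  kernelNormsV4_zero_of_klEng hR hU hU1 hK hμ (gfr0_abs_mul_le_of_le_klEngU₀3 hU hU₀) hβ hL hM
    (klScaleZeroThetaC_mul_le_half_of_le_klEngU₀3 hR hU hU₀) hP hQ

end Summit.HubbardSuperconductivity.HubbardSuperconductivity.Theorems.EngineV8

end
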